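import Literature.Computability.AlgebraicComplexity.BorderApolarityPerturb
import Literature.Computability.AlgebraicComplexity.StrassenMinimalBorderRank
import Literature.Computability.AlgebraicComplexity.BorderRankMatMul323Weights
import Literature.Computability.AlgebraicComplexity.BorderRankMatMul323Symmetry
import Literature.Computability.AlgebraicComplexity.BorderRankMatMulSmallProofs
import HarnessLib

/-!
# `R̲(⟨2,3,3⟩) = 14` (Conner–Harper–Landsberg 2023, Thm. 1.4(1)) — proved (torus-fixed border apolarity)

Topic `Literature/Computability/AlgebraicComplexity`.  The lower bound of Conner–Harper–Landsberg
2023, Thm. 1.4(1) (= Thm. 1.5(1) of the journal version), "`R̲(M_⟨233⟩) = 14`" (upper bound due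
to Smirnov 2013; §7.3: "There are nine `𝔹`-fixed four-dimensional subspaces of `U* ⊗ 𝔰𝔩(V) ⊗ W`"),
for the tree's ALGEBRAIC border rank `algBorderRank` over `K[ε]` (`SchoenhageTau.lean`) and every
field `K` of characteristic `0`, proved on the cyclic format `⟨3,2,3⟩` (`u = w = 3`, `v = 2`, as in
CHL §7.3) and rotated:

* `MatMul323.fourteen_le_algBorderRank_matMulTensor_323 : 14 ≤ algBorderRank (matMulTensor K 3 2 3)`;
* `MatMul323.fourteen_le_algBorderRank_matMulTensor_233`, `MatMul323.algBorderRank_matMulTensor_233 :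
  algBorderRank (matMulTensor K 2 3 3) = 14` (rotation `SchoenhageTauBini.lean`; upper bound the
  tree's `Smirnov2013_algBorderRank_matMulTensor_233_le`), and `…_323 = 14`;
* `ConnerHarperLandsberg2023_thm_1_4_233_holds` — the DISCHARGE of the named fact
  `ConnerHarperLandsberg2023_thm_1_4_233` (`BorderRankMatMulSmall.lean`) through the tree's reduction
  `ConnerHarperLandsberg2023_thm_1_4_233_iff_lower` (`BorderRankMatMulSmallProofs.lean`).

## The proof (CHL 2023, §2.3–§3 and §7.3, made elementary and torus-only; the tree's `⟨2,2,2⟩` and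
## `⟨2,2,3⟩` arguments transplanted, plus the Weyl-group reduction)

Suppose `R̲(⟨3,2,3⟩) ≤ 13`; then (`exists_isApproxDecomposition_of_approxRank_le`, padding with
zero triads) there is an order-`h` approximate decomposition with exactly `13` triads over `K[ε]`
(slots: output `C = K^{3×3}`, `A = K^{3×2}`, `B = K^{2×3}`).  Perturb generically
(`BorderApolarityPerturb.lean`), take `F = lim_{ε→0} I₁₁₀ ≤ K^{A* ⊗ B*}` (`BorderApolarityLimits.lean`):
`dim F ≥ 36 − 13 = 23`, `F ≤ M_⟨323⟩(C*)^⊥` (dim `27`), `dim (F · A*) ≤ dim S²A* ⊗ B* − 13 = 113`,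
`dim (F · B*) ≤ dim A* ⊗ S²B* − 13 = 113`.  Degenerate along `deg((i,j),(j',k)) = 9i − j + j' + 3k`
(`BorderRankMatMul323Weights.lean`): `in(F)` contains `≥ 23` of the `27` weight vectors `ω_k` and its
products have `dim ≤ 113`.  But by `MatMul323.rank_test_ge` (kernel certificate for the `322`
Weyl-orbit representatives, `BorderRankMatMul323CertSound.lean`, and the symmetry,
`BorderRankMatMul323Symmetry.lean`) any `23` of the `ω_k` have `(210)`- or `(120)`-products spanning
dimension `≥ 114`.

## References

* A. Conner, A. Harper, J. M. Landsberg, *New lower bounds for matrix multiplication and `det₃`*,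
  Forum Math. Pi 11 (2023) e17 = arXiv:1911.07981, Thm. 1.4(1) (= Thm. 1.5(1) of the journal
  version), §2.3–§2.5, §3 (tests), §4 (`M(C*)^⊥ = U* ⊗ 𝔰𝔩(V) ⊗ W`), §7.3 ("nine `𝔹`-fixed
  four-dimensional subspaces"). [ConnerHarperLandsberg2023]

## Design

No Borel fixed point theorem / Lie's theorem and no Hilbert scheme; torus normal form by the
initial-subspace count of `GradedInitialSubspace.lean`; all `C(27,4)` torus-fixed candidates instead
of CHL's nine Borel-fixed ones, reduced to `322` by the Weyl group.
-/

noncomputable section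

open scoped BigOperators Polynomial
open Polynomial

namespace Literature.Computability.AlgebraicComplexity

namespace MatMul323

universe u

/-! ## `dim S²A* ⊗ B* ≤ 126`, `dim A* ⊗ S²B* ≤ 126` -/

section SymBound

variable (L : Type u) [Field L]

/-- The coordinates `(a, a', b)` with `a ≤ a'` number `126 = 21 · 6`.
[cite: ConnerHarperLandsberg2023, §7.3 (dimension count of the (210)-test)] -/
theorem card_ordA : Fintype.card {t : A32 × A32 × B23 // encA t.1 ≤ encA t.2.1} = 126 := by rfl

/-- The coordinates `(a, b, b')` with `b ≤ b'` number `126 = 6 · 21`.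
[cite: ConnerHarperLandsberg2023, §7.3 (dimension count of the (120)-test)] -/
theorem card_ordB : Fintype.card {t : A32 × B23 × B23 // encB t.2.1 ≤ encB t.2.2} = 126 := by rfl

/-- `dim S²A* ⊗ B* ≤ 126` for `⟨3,2,3⟩` (symmetric tensors are determined by their coordinates with
`a ≤ a'`). [cite: ConnerHarperLandsberg2023, §7.3] -/
theorem finrank_symA_le : Module.finrank L (symA L (α := A32) (β := B23)) ≤ 126 := by
  let res : symA L (α := A32) (β := B23) →ₗ[L] ({t : A32 × A32 × B23 // encA t.1 ≤ encA t.2.1} → L) :=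
    { toFun := fun γ t => (γ : A32 × A32 × B23 → L) t.1
      map_add' := fun _ _ => rfl
      map_smul' := fun _ _ => rfl }
  have hinj : Function.Injective res := by
    intro γ γ' hγ
    apply Subtype.ext
    funext ⟨a, a', b⟩
    rcases le_total (encA a) (encA a') with hle | hle
    · exact congr_fun hγ ⟨(a, a', b), hle⟩
    · have h1 : (γ : A32 × A32 × B23 → L) (a', a, b) = (γ' : A32 × A32 × B23 → L) (a', a, b) :=
        congr_fun hγ ⟨(a', a, b), hle⟩
      rw [γ.2 a a' b, γ'.2 a a' b]
      exact h1
  calc Module.finrank L (symA L (α := A32) (β := B23))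
      ≤ Module.finrank L ({t : A32 × A32 × B23 // encA t.1 ≤ encA t.2.1} → L) :=
        LinearMap.finrank_le_finrank_of_injective hinj
    _ = 126 := by rw [Module.finrank_fintype_fun_eq_card, card_ordA]

/-- `dim A* ⊗ S²B* ≤ 126` for `⟨3,2,3⟩`. [cite: ConnerHarperLandsberg2023, §7.3] -/
theorem finrank_symB_le : Module.finrank L (symB L (α := A32) (β := B23)) ≤ 126 := by
  let res : symB L (α := A32) (β := B23) →ₗ[L] ({t : A32 × B23 × B23 // encB t.2.1 ≤ encB t.2.2} → L) :=
    { toFun := fun γ t => (γ : A32 × B23 × B23 → L) t.1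
      map_add' := fun _ _ => rfl
      map_smul' := fun _ _ => rfl }
  have hinj : Function.Injective res := by
    intro γ γ' hγ
    apply Subtype.ext
    funext ⟨a, b, b'⟩
    rcases le_total (encB b) (encB b') with hle | hle
    · exact congr_fun hγ ⟨(a, b, b'), hle⟩
    · have h1 : (γ : A32 × B23 × B23 → L) (a, b', b) = (γ' : A32 × B23 × B23 → L) (a, b', b) :=
        congr_fun hγ ⟨(a, b', b), hle⟩
      rw [γ.2 a b b', γ'.2 a b b']
      exact h1
  calc Module.finrank L (symB L (α := A32) (β := B23))
      ≤ Module.finrank L ({t : A32 × B23 × B23 // encB t.2.1 ≤ encB t.2.2} → L) :=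
        LinearMap.finrank_le_finrank_of_injective hinj
    _ = 126 := by rw [Module.finrank_fintype_fun_eq_card, card_ordB]

end SymBound

/-! ## The theorem -/

section Main

variable (K : Type u) [Field K] [CharZero K]

omit [CharZero K] in
/-- The `(210)` test products are the `(210)` products of the weight vectors.
[cite: ConnerHarperLandsberg2023, §3 (the (210)-map)] -/
theorem rowFunA_eq (k : Fin 27) (a₀ : A32) : rowFunA K k a₀ = MatMulTwo.mul210 K a₀ (wv K k) := by
  funext t; rfl

omit [CharZero K] in
/-- The `(120)` test products are the `(120)` products of the weight vectors.
[cite: ConnerHarperLandsberg2023, §3 (the (120)-map)] -/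
theorem rowFunB_eq (k : Fin 27) (b₀ : B23) : rowFunB K k b₀ = MatMulTwo.mul120 K b₀ (wv K k) := by
  funext t; rfl

/-- **`R̲(⟨3,2,3⟩) ≥ 14` over every field of characteristic `0`** (Conner–Harper–Landsberg 2023,
Thm. 1.4(1), lower half, on the cyclic format `u = w = 3`, `v = 2` of their §7.3; here by the
torus-fixed border apolarity argument of the module docstring), for the algebraic border rank over
`K[ε]`. [cite: ConnerHarperLandsberg2023, Thm. 1.4(1) and §7.3] -/
theorem fourteen_le_algBorderRank_matMulTensor_323 : 14 ≤ algBorderRank (matMulTensor K 3 2 3) := by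
  classical
  set t := matMulTensor K 3 2 3 with ht
  by_contra hlt
  push Not at hlt
  -- an order-`h` approximate decomposition with exactly `13` triads (padding with zeros)
  obtain ⟨h, hh⟩ : ∃ h, approxRank h t = algBorderRank t :=
    Nat.sInf_mem (Set.range_nonempty fun h : ℕ => approxRank h t)
  have hr13 : approxRank h t ≤ 13 := by omega
  obtain ⟨u, v, w, huvw⟩ := exists_isApproxDecomposition_of_approxRank_le hr13
  -- thirteen distinct coordinate pairs
  have hr36 : 13 ≤ Fintype.card (A32 × B23) := by
    simp [Fintype.card_prod, Fintype.card_fin]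
  set pts : Fin 13 → A32 × B23 := fun ρ => (Fintype.equivFin (A32 × B23)).symm (Fin.castLE hr36 ρ)
    with hpts
  have hinj : Function.Injective fun ρ => ((pts ρ).1, (pts ρ).2) := by
    simp only [Prod.mk.eta]
    exact (Fintype.equivFin (A32 × B23)).symm.injective.comp (Fin.castLE_injective hr36)
  -- `N` beyond `h` and all degrees
  set N := h + 1 + (∑ ρ, ∑ a, (v ρ a).natDegree + ∑ ρ, ∑ b, (w ρ b).natDegree) with hN_def
  have hNh : h < N := by omega
  have hN0 : 0 < N := by omega
  have hv : ∀ ρ a, (v ρ a).natDegree < N := by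
    intro ρ a
    have h1 : (v ρ a).natDegree ≤ ∑ a, (v ρ a).natDegree :=
      Finset.single_le_sum (f := fun a => (v ρ a).natDegree) (fun _ _ => Nat.zero_le _)
        (Finset.mem_univ a)
    have h2 : ∑ a, (v ρ a).natDegree ≤ ∑ ρ, ∑ a, (v ρ a).natDegree :=
      Finset.single_le_sum (f := fun ρ => ∑ a, (v ρ a).natDegree) (fun _ _ => Nat.zero_le _)
        (Finset.mem_univ ρ)
    omega
  have hw : ∀ ρ b, (w ρ b).natDegree < N := by
    intro ρ b
    have h1 : (w ρ b).natDegree ≤ ∑ b, (w ρ b).natDegree :=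
      Finset.single_le_sum (f := fun b => (w ρ b).natDegree) (fun _ _ => Nat.zero_le _)
        (Finset.mem_univ b)
    have h2 : ∑ b, (w ρ b).natDegree ≤ ∑ ρ, ∑ b, (w ρ b).natDegree :=
      Finset.single_le_sum (f := fun ρ => ∑ b, (w ρ b).natDegree) (fun _ _ => Nat.zero_le _)
        (Finset.mem_univ ρ)
    omega
  -- the perturbed decomposition and its `(110)` limit space `F`
  have hdec := isApproxDecomposition_pert v w (fun ρ => (pts ρ).1) (fun ρ => (pts ρ).2) N huvw hNh
  set x' := pertX v (fun ρ => (pts ρ).1) N with hx'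
  set y' := pertY w (fun ρ => (pts ρ).2) N with hy'
  let L := FractionRing K[X]
  set F : Submodule K (A32 × B23 → K) := limSub K L (I11 L x' y') with hF_def
  have hcard : Fintype.card A32 * Fintype.card B23 = 36 := by
    simp [Fintype.card_prod, Fintype.card_fin]
  have hF23 : 23 ≤ Module.finrank K F := by
    have h1 := finrank_limSub_eq K L (I11 L x' y')
    have h2 := finrank_I11_ge L x' y'
    rw [hcard] at h2
    rw [hF_def, h1]
    omega
  have hFann : F ≤ annSub t := limSub_I11_le_annSub L x' y' hdec
  -- the `(210)` and `(120)` products of `F`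
  set G₁ : Submodule K (A32 × A32 × B23 → K) := ⨆ a₀ : A32, F.map (MatMulTwo.mul210 K a₀)
    with hG₁_def
  set G₂ : Submodule K (A32 × B23 × B23 → K) := ⨆ b₀ : B23, F.map (MatMulTwo.mul120 K b₀)
    with hG₂_def
  have hG₁ : Module.finrank K G₁ ≤ 113 := by
    have hle : G₁ ≤ limSub K L (I21 L x' y') := iSup_le fun a₀ => map_mul210_limSub_le L x' y' a₀
    have h1 : Module.finrank K (limSub K L (I21 L x' y')) = Module.finrank L (I21 L x' y') :=
      finrank_limSub_eq K L (I21 L x' y')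
    have h2 : Module.finrank L (I21 L x' y') + 13 ≤ Module.finrank L (symA L (α := A32) (β := B23)) := by
      simpa only [hx', hy'] using finrank_I21_pert_add_le L hinj hv hw hN0
    have h3 := finrank_symA_le L
    have h4 : Module.finrank K G₁ ≤ Module.finrank K (limSub K L (I21 L x' y')) :=
      Submodule.finrank_mono hle
    omega
  have hG₂ : Module.finrank K G₂ ≤ 113 := by
    have hle : G₂ ≤ limSub K L (I12 L x' y') := iSup_le fun b₀ => map_mul120_limSub_le L x' y' b₀
    have h1 : Module.finrank K (limSub K L (I12 L x' y')) = Module.finrank L (I12 L x' y') :=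
      finrank_limSub_eq K L (I12 L x' y')
    have h2 : Module.finrank L (I12 L x' y') + 13 ≤ Module.finrank L (symB L (α := A32) (β := B23)) := by
      simpa only [hx', hy'] using finrank_I12_pert_add_le L hinj hv hw hN0
    have h3 := finrank_symB_le L
    have h4 : Module.finrank K G₂ ≤ Module.finrank K (limSub K L (I12 L x' y')) :=
      Submodule.finrank_mono hle
    omega
  -- the torus degeneration of `F` contains `≥ 23` weight vectors
  set S := Finset.univ.filter fun k : Fin 27 => wv K k ∈ inPart deg2 F (wdeg k) with hS_def
  have hS : 23 ≤ S.card := hF23.trans (finrank_le_card_weightLines hFann)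
  -- but those fail a test
  rcases rank_test_ge K S hS with h114 | h114
  · set InG : Submodule K (A32 × A32 × B23 → K) :=
      ⨆ i ∈ Finset.range 46, inPart deg3A G₁ (-2 + i) with hInG
    have hspan : Submodule.span K (genSetA K S) ≤ InG := by
      refine Submodule.span_le.2 ?_
      rintro _ ⟨k, hk, a₀, rfl⟩
      rw [hS_def, Finset.mem_filter] at hk
      rw [rowFunA_eq]
      have h1 : MatMulTwo.mul210 K a₀ (wv K k) ∈ inPart deg3A G₁ (wdeg k + degA a₀) := by
        refine inPart_mono deg3A (le_iSup (fun a₀ : A32 => F.map (MatMulTwo.mul210 K a₀)) a₀) _ ?_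
        exact map_inPart_le deg2 deg3A (MatMulTwo.mul210 K a₀) (degA a₀) (mul210_mem_Vge K a₀)
          (projDeg_mul210 K a₀) F (wdeg k) (Submodule.mem_map_of_mem hk.2)
      have hwin := wdeg_add_degA_window k a₀
      obtain ⟨i, hi, hieq⟩ : ∃ i : ℕ, i ∈ Finset.range 46 ∧ (-2 : ℤ) + i = wdeg k + degA a₀ :=
        ⟨(wdeg k + degA a₀ + 2).toNat, by rw [Finset.mem_range]; omega, by omega⟩
      rw [← hieq] at h1
      exact (le_iSup₂ (f := fun i (_ : i ∈ Finset.range 46) => inPart deg3A G₁ (-2 + i)) i hi) h1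
    have hIn := finrank_biSup_inPart_le deg3A G₁ (-2) 46 (fun t => (deg3A_window t).1)
      (fun t => (deg3A_window t).2)
    have := (Submodule.finrank_mono hspan).trans hIn
    omega
  · set InG : Submodule K (A32 × B23 × B23 → K) :=
      ⨆ i ∈ Finset.range 34, inPart deg3B G₂ (-1 + i) with hInG
    have hspan : Submodule.span K (genSetB K S) ≤ InG := by
      refine Submodule.span_le.2 ?_
      rintro _ ⟨k, hk, b₀, rfl⟩
      rw [hS_def, Finset.mem_filter] at hk
      rw [rowFunB_eq]
      have h1 : MatMulTwo.mul120 K b₀ (wv K k) ∈ inPart deg3B G₂ (wdeg k + degB b₀) := by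
        refine inPart_mono deg3B (le_iSup (fun b₀ : B23 => F.map (MatMulTwo.mul120 K b₀)) b₀) _ ?_
        exact map_inPart_le deg2 deg3B (MatMulTwo.mul120 K b₀) (degB b₀) (mul120_mem_Vge K b₀)
          (projDeg_mul120 K b₀) F (wdeg k) (Submodule.mem_map_of_mem hk.2)
      have hwin := wdeg_add_degB_window k b₀
      obtain ⟨i, hi, hieq⟩ : ∃ i : ℕ, i ∈ Finset.range 34 ∧ (-1 : ℤ) + i = wdeg k + degB b₀ :=
        ⟨(wdeg k + degB b₀ + 1).toNat, by rw [Finset.mem_range]; omega, by omega⟩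
      rw [← hieq] at h1
      exact (le_iSup₂ (f := fun i (_ : i ∈ Finset.range 34) => inPart deg3B G₂ (-1 + i)) i hi) h1
    have hIn := finrank_biSup_inPart_le deg3B G₂ (-1) 34 (fun t => (deg3B_window t).1)
      (fun t => (deg3B_window t).2)
    have := (Submodule.finrank_mono hspan).trans hIn
    omega

/-- **`R̲(⟨2,3,3⟩) ≥ 14` over every field of characteristic `0`** (CHL 2023, Thm. 1.4(1), lower
half, in the format `matMulTensor K 2 3 3` of the named fact; from the `⟨3,2,3⟩` bound by two cyclic
rotations, `approxRank_matMulTensor_rotate_le`). [cite: ConnerHarperLandsberg2023, Thm. 1.4(1)] -/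
theorem fourteen_le_algBorderRank_matMulTensor_233 : 14 ≤ algBorderRank (matMulTensor K 2 3 3) := by
  obtain ⟨h₀, hh₀⟩ := exists_algBorderRank_eq_approxRank (matMulTensor K 2 3 3)
  have hrot : algBorderRank (matMulTensor K 3 2 3) ≤ algBorderRank (matMulTensor K 2 3 3) := by
    rw [hh₀]
    exact (algBorderRank_le_approxRank h₀ _).trans
      ((approxRank_matMulTensor_rotate_le K h₀ 3 3 2).trans
        (approxRank_matMulTensor_rotate_le K h₀ 2 3 3))
  exact (fourteen_le_algBorderRank_matMulTensor_323 K).trans hrot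

/-- **`R̲(⟨2,3,3⟩) = 14` over EVERY field of characteristic `0`** (CHL 2023, Thm. 1.4(1), stated
there over `ℂ`; upper bound: Smirnov 2013, in the tree as `Smirnov2013_algBorderRank_matMulTensor_233_le`
over any commutative ring). [cite: ConnerHarperLandsberg2023, Thm. 1.4(1)] [cite: Smirnov2013, Table 4] -/
theorem algBorderRank_matMulTensor_233 : algBorderRank (matMulTensor K 2 3 3) = 14 :=
  le_antisymm (Smirnov2013_algBorderRank_matMulTensor_233_le K)
    (fourteen_le_algBorderRank_matMulTensor_233 K)

/-- **`R̲(⟨3,2,3⟩) = 14` over every field of characteristic `0`** (the cyclic format; upper bound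
`Smirnov2013_algBorderRank_matMulTensor_323_le`). [cite: ConnerHarperLandsberg2023, Thm. 1.4(1)]
[cite: Smirnov2013, Table 4] -/
theorem algBorderRank_matMulTensor_323 : algBorderRank (matMulTensor K 3 2 3) = 14 :=
  le_antisymm (Smirnov2013_algBorderRank_matMulTensor_323_le K)
    (fourteen_le_algBorderRank_matMulTensor_323 K)

end Main

end MatMul323

/-- **Conner–Harper–Landsberg 2023, Thm. 1.4(1): `R̲(M_⟨233⟩) = 14`** — the named fact
`ConnerHarperLandsberg2023_thm_1_4_233` (`BorderRankMatMulSmall.lean`), DISCHARGED for the tree's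
algebraic border rank over `ℂ[ε]` (lower half: `MatMul323.fourteen_le_algBorderRank_matMulTensor_233`,
torus-fixed border apolarity with a kernel-checked, Weyl-symmetry-reduced certificate; upper half:
Smirnov 2013, in the tree). [cite: ConnerHarperLandsberg2023, Thm. 1.4(1)] -/
theorem ConnerHarperLandsberg2023_thm_1_4_233_holds : ConnerHarperLandsberg2023_thm_1_4_233 :=
  ConnerHarperLandsberg2023_thm_1_4_233_iff_lower.2
    (MatMul323.fourteen_le_algBorderRank_matMulTensor_233 ℂ)

end Literature.Computability.AlgebraicComplexity

end
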